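import Summits.QuantumFields.BalabanUV.Beta.GAN24.StripAliasGoodBlocks
import Summits.QuantumFields.BalabanUV.Beta.GAN24.FibreBlockBounds

/-!
# `BalabanUV.Beta.GAN24.StripAliasBlockSolve` — binder row G-an2-4 / (CONV-C), road P1-fibre, typer row **L10(i) = Y10g\*** part 5 (= typer
# addendum (b′) of `GAN24/Formal/LEAVES.md` v2.7 § II.A3): THE GOOD BLOCKS' EXPLICIT SOLUTION `FibreBlockSolve.Asol/musol` AT COMPLEX `p` obeys the
# REAL-zone `FibreBlockBounds` inequalities with the real sizes × `N`-free constants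

NOT IN PRINT; OUR PROOF ATTEMPT.  HONEST FRAMING (cell contract, verbatim): «discharging `BetaPertH` makes Bałaban's UV stability
UNCONDITIONAL — a real constructive-QFT result; it is NOT the continuum limit and NOT the Clay problem.»  HONEST DEPENDENCY (verbatim):
«continuum YM on T⁴ ⇐ BetaPertH ∧ nine spine estimates (0/9 proved); BetaPertH ⇐ (D1) ∧ (D4) ∧ CAP+tail; G-an2-4 gates asym, D1 and
NE2/3/4.»  [folklore] bookkeeping estimates; NO cited fact, NO `def … : Prop` hypothesis, NO wall binder, NO new object.  NOT summit
progress; nothing of (CONV-C)'s K-slot is discharged here.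

## What is proved (general `D`, `N ≥ 1`; complex `p` with `hre : ∀ i, |(p i).re| ≤ π`, `him : ∀ i, |(p i).im| ≤ η`, `0 ≤ η ≤ 1`, SMALLNESS
## `hsm : (3D/2 + 2)·η ≤ 1/2`; a NONZERO alias `m`; `L := lapR (kfine N (reVec p) m) > 0` its REAL Laplacian symbol; `‖g‖₂ := √(Σ_κ ‖g_κ‖²)`)
`FibreBlockBounds` §2 (general complex data: `norm_projT_le`, `norm_Asol_le`, `norm_musol`, `norm_dot_Asol`, `norm_dot_le`) + part 2
`StripAliasGoodBlocks` (`L/2 ≤ ‖L_m(p)‖`, `Σ_κ‖∂♭_{mκ}(p)‖² ≤ 4L`, `‖∂_{mκ}(p)‖ ≤ 2√L`):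
* `sqrt_sum_norm_dbAl_sq_le` / `sqrt_sum_norm_dAl_sq_le` (`‖∂♭_m(p)‖₂, ‖∂_m(p)‖₂ ≤ 2√L`), `norm_dot_dbAl_le` (`‖∂♭_m·g‖ ≤ 2√L·‖g‖₂`),
  `norm_dot_dAl_le`;
* **`norm_projT_strip_le`** (`‖(Π⊥_m g)_κ‖ ≤ ‖g_κ‖ + 8‖g‖₂`; real zone: `≤ ‖g‖₂`), `norm_projT_strip_le'` (`≤ 9‖g‖₂`);
* **`norm_Asol_strip_le`** (`‖Asol_κ‖ ≤ 9‖g‖₂/L + 8‖cc‖/(L√L)`; real zone `‖g‖₂/(2L) + ‖cc‖/(L√L)`), **`norm_musol_strip_le`** (`‖musol‖ ≤ 8‖g‖₂/(L√L)`; real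
  zone `‖g‖₂/(L√L)`), **`norm_dot_dbAl_Asol_strip`** (`‖∂♭_m·Asol‖ = ‖cc‖/‖L_m(p)‖ ≤ 2‖cc‖/L`) — the `|∂̂|⁻²`, `|∂̂|⁻³` orders of SKELETON A3 survive
  on the strip with constants `18, 8, 8, 2`;
* the `N`-SCALED corollaries (`4 ≤ N²L`): `inv_lapR_le` (`1/L ≤ N²/4`), `inv_lapR_sqrt_le` (`1/(L√L) ≤ N³/8`).
Unit `b2b-balaban-gan24-formalise-leaf-18` (G-an2-4 formalisation swarm), 2026-08-20.
-/

noncomputable section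

open Complex Finset
open scoped BigOperators Real
open Literature.Probability.LatticeModels (TorusSite)
open Literature.MathematicalPhysics.QuantumFieldTheory
open Literature.MathematicalPhysics.QuantumFieldTheory.Balaban1983to89
open B4Strip (ofRealVec reVec)
open Summit.QuantumFields.BalabanUV.Beta.GAN24.AliasWeights (kfine)
open Summit.QuantumFields.BalabanUV.Beta.GAN24.AliasWeightsSum (lapR lapR_nonneg)
open Summit.QuantumFields.BalabanUV.Beta.GAN24.AliasObjects (dAl dbAl LAl dot_dbAl_dAl)
open Summit.QuantumFields.BalabanUV.Beta.GAN24.FibreBlockSolve (dot Asol musol)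
open Summit.QuantumFields.BalabanUV.Beta.GAN24.TransverseProjector (projT)
open Summit.QuantumFields.BalabanUV.Beta.GAN24.FibreBlockBounds (norm_dot_le norm_projT_le norm_Asol_le norm_musol norm_dot_Asol)
open Summit.QuantumFields.BalabanUV.Beta.GAN24.StripAliasBounds (four_le_sq_mul_lapR_re)
open Summit.QuantumFields.BalabanUV.Beta.GAN24.StripAliasGoodBlocks (lapR_pos_of_ne_zero half_lapR_le_norm_LAl LAl_ne_zero_of_strip
  sum_norm_dAl_sq_le sum_norm_dbAl_sq_le norm_dAl_le_two_sqrt norm_dbAl_le_two_sqrt le_two_sqrt_of_sq_le)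

namespace Summit.QuantumFields.BalabanUV.Beta.GAN24.StripAliasBlockSolve

variable {D : ℕ} {N : ℕ} [NeZero N] {p : Fin D → ℂ} {η : ℝ} {m : TorusSite D N}

/-! ## §1 `ℓ²` sizes of `∂_m(p)`, `∂♭_m(p)` and the pairings `∂♭_m·g`, `∂_m·g` -/

/-- [folklore] `‖∂♭_m(p)‖₂ ≤ 2√L`. -/
theorem sqrt_sum_norm_dbAl_sq_le (hre : ∀ i, |(p i).re| ≤ π) (him : ∀ i, |(p i).im| ≤ η) (hη : 0 ≤ η) (hη1 : η ≤ 1)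
    (hsm : (3 * D / 2 + 2) * η ≤ 1 / 2) (hm : m ≠ 0) :
    Real.sqrt (∑ κ, ‖dbAl N p m κ‖ ^ 2) ≤ 2 * Real.sqrt (lapR (kfine N (reVec p) m)) := by
  have h := sum_norm_dbAl_sq_le hre him hη hη1 hsm hm
  have h2 : Real.sqrt (∑ κ, ‖dbAl N p m κ‖ ^ 2) ^ 2 ≤ 4 * lapR (kfine N (reVec p) m) := by
    rw [Real.sq_sqrt (Finset.sum_nonneg fun κ _ => sq_nonneg _)]; exact h
  exact le_two_sqrt_of_sq_le (lapR_nonneg _) h2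

/-- [folklore] `‖∂_m(p)‖₂ ≤ 2√L`. -/
theorem sqrt_sum_norm_dAl_sq_le (hre : ∀ i, |(p i).re| ≤ π) (him : ∀ i, |(p i).im| ≤ η) (hη : 0 ≤ η) (hη1 : η ≤ 1)
    (hsm : (3 * D / 2 + 2) * η ≤ 1 / 2) (hm : m ≠ 0) :
    Real.sqrt (∑ κ, ‖dAl N p m κ‖ ^ 2) ≤ 2 * Real.sqrt (lapR (kfine N (reVec p) m)) := by
  have h := sum_norm_dAl_sq_le hre him hη hη1 hsm hm
  have h2 : Real.sqrt (∑ κ, ‖dAl N p m κ‖ ^ 2) ^ 2 ≤ 4 * lapR (kfine N (reVec p) m) := by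
    rw [Real.sq_sqrt (Finset.sum_nonneg fun κ _ => sq_nonneg _)]; exact h
  exact le_two_sqrt_of_sq_le (lapR_nonneg _) h2

/-- [folklore] **`‖∂♭_m(p)·g‖ ≤ 2√L·‖g‖₂`** (Cauchy–Schwarz). -/
theorem norm_dot_dbAl_le (hre : ∀ i, |(p i).re| ≤ π) (him : ∀ i, |(p i).im| ≤ η) (hη : 0 ≤ η) (hη1 : η ≤ 1)
    (hsm : (3 * D / 2 + 2) * η ≤ 1 / 2) (hm : m ≠ 0) (g : Fin D → ℂ) :
    ‖dot (dbAl N p m) g‖ ≤ 2 * Real.sqrt (lapR (kfine N (reVec p) m)) * Real.sqrt (∑ κ, ‖g κ‖ ^ 2) :=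
  (norm_dot_le _ _).trans (mul_le_mul_of_nonneg_right (sqrt_sum_norm_dbAl_sq_le hre him hη hη1 hsm hm) (Real.sqrt_nonneg _))

/-- [folklore] **`‖∂_m(p)·g‖ ≤ 2√L·‖g‖₂`**. -/
theorem norm_dot_dAl_le (hre : ∀ i, |(p i).re| ≤ π) (him : ∀ i, |(p i).im| ≤ η) (hη : 0 ≤ η) (hη1 : η ≤ 1)
    (hsm : (3 * D / 2 + 2) * η ≤ 1 / 2) (hm : m ≠ 0) (g : Fin D → ℂ) :
    ‖dot (dAl N p m) g‖ ≤ 2 * Real.sqrt (lapR (kfine N (reVec p) m)) * Real.sqrt (∑ κ, ‖g κ‖ ^ 2) :=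
  (norm_dot_le _ _).trans (mul_le_mul_of_nonneg_right (sqrt_sum_norm_dAl_sq_le hre him hη hη1 hsm hm) (Real.sqrt_nonneg _))

/-! ## §2 The transverse part, the field solution and the gauge multiplier of a good block at complex `p` -/

/-- [folklore] **TRANSVERSE PART ON THE STRIP**: `‖(Π⊥_m g)_κ‖ ≤ ‖g_κ‖ + 8‖g‖₂` (`‖∂♭·g‖·‖∂_κ‖/‖L_m(p)‖ ≤ 2√L‖g‖₂ · 2√L / (L/2)`). -/
theorem norm_projT_strip_le (hre : ∀ i, |(p i).re| ≤ π) (him : ∀ i, |(p i).im| ≤ η) (hη : 0 ≤ η) (hη1 : η ≤ 1)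
    (hsm : (3 * D / 2 + 2) * η ≤ 1 / 2) (hm : m ≠ 0) (g : Fin D → ℂ) (κ : Fin D) :
    ‖projT (dAl N p m) (dbAl N p m) (LAl N p m) g κ‖ ≤ ‖g κ‖ + 8 * Real.sqrt (∑ l, ‖g l‖ ^ 2) := by
  set L := lapR (kfine N (reVec p) m) with hL
  have hLpos : 0 < L := lapR_pos_of_ne_zero (N := N) hre hm
  have hLA := half_lapR_le_norm_LAl hre him hη hη1 hsm hm
  have hLA0 : 0 < ‖LAl N p m‖ := by linarith
  have h := norm_projT_le (dAl N p m) (dbAl N p m) g (LAl N p m) κ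
  have hdot := norm_dot_dbAl_le hre him hη hη1 hsm hm g
  have hdd := norm_dAl_le_two_sqrt hre him hη hη1 hm κ
  set G := Real.sqrt (∑ l, ‖g l‖ ^ 2) with hG
  have hG0 : 0 ≤ G := Real.sqrt_nonneg _
  have hsq : Real.sqrt L * Real.sqrt L = L := Real.mul_self_sqrt hLpos.le
  have hs0 : 0 ≤ Real.sqrt L := Real.sqrt_nonneg _
  -- `‖∂♭·g‖/‖L_m(p)‖·‖∂_κ‖ ≤ (2√L G)(2√L)/(L/2) = 8G`
  have hkey : ‖dot (dbAl N p m) g‖ / ‖LAl N p m‖ * ‖dAl N p m κ‖ ≤ 8 * G := by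
    rw [div_mul_eq_mul_div, div_le_iff₀ hLA0]
    calc ‖dot (dbAl N p m) g‖ * ‖dAl N p m κ‖ ≤ (2 * Real.sqrt L * G) * (2 * Real.sqrt L) :=
          mul_le_mul hdot hdd (norm_nonneg _) (by positivity)
      _ = 4 * L * G := by rw [show (2 * Real.sqrt L * G) * (2 * Real.sqrt L) = 4 * (Real.sqrt L * Real.sqrt L) * G by ring, hsq]
      _ ≤ 8 * G * ‖LAl N p m‖ := by nlinarith
  linarith

/-- [folklore] `‖(Π⊥_m g)_κ‖ ≤ 9‖g‖₂` on the strip. -/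
theorem norm_projT_strip_le' (hre : ∀ i, |(p i).re| ≤ π) (him : ∀ i, |(p i).im| ≤ η) (hη : 0 ≤ η) (hη1 : η ≤ 1)
    (hsm : (3 * D / 2 + 2) * η ≤ 1 / 2) (hm : m ≠ 0) (g : Fin D → ℂ) (κ : Fin D) :
    ‖projT (dAl N p m) (dbAl N p m) (LAl N p m) g κ‖ ≤ 9 * Real.sqrt (∑ l, ‖g l‖ ^ 2) := by
  have h := norm_projT_strip_le hre him hη hη1 hsm hm g κ
  have hκ : ‖g κ‖ ≤ Real.sqrt (∑ l, ‖g l‖ ^ 2) := by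
    refine Real.le_sqrt_of_sq_le ?_
    exact Finset.single_le_sum (f := fun l => ‖g l‖ ^ 2) (fun l _ => sq_nonneg _) (Finset.mem_univ κ)
  linarith

/-- [folklore] **FIELD SOLUTION OF A GOOD BLOCK ON THE STRIP**: `‖Asol_κ‖ ≤ 9‖g‖₂/L + 8‖cc‖/(L√L)` — the real-zone orders `|∂̂|⁻²` (transverse) and
`|∂̂|⁻³` (gauge column) of SKELETON-P1 A3, with `N`-free constants. -/
theorem norm_Asol_strip_le (hre : ∀ i, |(p i).re| ≤ π) (him : ∀ i, |(p i).im| ≤ η) (hη : 0 ≤ η) (hη1 : η ≤ 1)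
    (hsm : (3 * D / 2 + 2) * η ≤ 1 / 2) (hm : m ≠ 0) (g : Fin D → ℂ) (cc : ℂ) (κ : Fin D) :
    ‖Asol (dAl N p m) (dbAl N p m) g (LAl N p m) cc κ‖
      ≤ 9 * Real.sqrt (∑ l, ‖g l‖ ^ 2) / lapR (kfine N (reVec p) m)
        + 8 * ‖cc‖ / (lapR (kfine N (reVec p) m) * Real.sqrt (lapR (kfine N (reVec p) m))) := by
  set L := lapR (kfine N (reVec p) m) with hL
  have hLpos : 0 < L := lapR_pos_of_ne_zero (N := N) hre hm
  have hLA := half_lapR_le_norm_LAl hre him hη hη1 hsm hm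
  have hLA0 : 0 < ‖LAl N p m‖ := by linarith
  have h := norm_Asol_le (dAl N p m) (dbAl N p m) g (LAl N p m) cc κ
  have hP := norm_projT_strip_le' hre him hη hη1 hsm hm g κ
  have hdd := norm_dAl_le_two_sqrt hre him hη hη1 hm κ
  set G := Real.sqrt (∑ l, ‖g l‖ ^ 2) with hG
  have hG0 : 0 ≤ G := Real.sqrt_nonneg _
  have hs0 : 0 < Real.sqrt L := Real.sqrt_pos.2 hLpos
  have hsq : Real.sqrt L * Real.sqrt L = L := Real.mul_self_sqrt hLpos.le
  -- transverse term: `‖Π⊥g‖/(2‖L_m(p)‖) ≤ 9G/(2·L/2) = 9G/L`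
  have h1 : ‖projT (dAl N p m) (dbAl N p m) (LAl N p m) g κ‖ / (2 * ‖LAl N p m‖) ≤ 9 * G / L := by
    rw [div_le_div_iff₀ (by positivity) hLpos]
    calc ‖projT (dAl N p m) (dbAl N p m) (LAl N p m) g κ‖ * L ≤ 9 * G * L := mul_le_mul_of_nonneg_right hP hLpos.le
      _ ≤ 9 * G * (2 * ‖LAl N p m‖) := by nlinarith
  -- gauge term: `‖cc‖‖∂_κ‖/‖L_m(p)‖² ≤ ‖cc‖·2√L/(L²/4) = 8‖cc‖/(L√L)`
  have h2 : ‖cc‖ * ‖dAl N p m κ‖ / ‖LAl N p m‖ ^ 2 ≤ 8 * ‖cc‖ / (L * Real.sqrt L) := by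
    rw [div_le_div_iff₀ (by positivity) (by positivity)]
    have hL2 : L ^ 2 / 4 ≤ ‖LAl N p m‖ ^ 2 := by nlinarith
    calc ‖cc‖ * ‖dAl N p m κ‖ * (L * Real.sqrt L) ≤ ‖cc‖ * (2 * Real.sqrt L) * (L * Real.sqrt L) := by gcongr
      _ = 2 * ‖cc‖ * L * (Real.sqrt L * Real.sqrt L) := by ring
      _ = 2 * ‖cc‖ * L * L := by rw [hsq]
      _ = 8 * ‖cc‖ * (L ^ 2 / 4) := by ring
      _ ≤ 8 * ‖cc‖ * ‖LAl N p m‖ ^ 2 := by gcongr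
  exact h.trans (add_le_add h1 h2)

/-- [folklore] **GAUGE MULTIPLIER OF A GOOD BLOCK ON THE STRIP**: `‖musol‖ ≤ 8‖g‖₂/(L√L)` (real zone: `‖g‖₂/(L√L)`). -/
theorem norm_musol_strip_le (hre : ∀ i, |(p i).re| ≤ π) (him : ∀ i, |(p i).im| ≤ η) (hη : 0 ≤ η) (hη1 : η ≤ 1)
    (hsm : (3 * D / 2 + 2) * η ≤ 1 / 2) (hm : m ≠ 0) (g : Fin D → ℂ) :
    ‖musol (dbAl N p m) g (LAl N p m)‖
      ≤ 8 * Real.sqrt (∑ l, ‖g l‖ ^ 2) / (lapR (kfine N (reVec p) m) * Real.sqrt (lapR (kfine N (reVec p) m))) := by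
  set L := lapR (kfine N (reVec p) m) with hL
  have hLpos : 0 < L := lapR_pos_of_ne_zero (N := N) hre hm
  have hLA := half_lapR_le_norm_LAl hre him hη hη1 hsm hm
  have hLA0 : 0 < ‖LAl N p m‖ := by linarith
  rw [norm_musol]
  have hdot := norm_dot_dbAl_le hre him hη hη1 hsm hm g
  set G := Real.sqrt (∑ l, ‖g l‖ ^ 2) with hG
  have hG0 : 0 ≤ G := Real.sqrt_nonneg _
  have hs0 : 0 < Real.sqrt L := Real.sqrt_pos.2 hLpos
  have hsq : Real.sqrt L * Real.sqrt L = L := Real.mul_self_sqrt hLpos.le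
  rw [div_le_div_iff₀ (by positivity) (by positivity)]
  have hL2 : L ^ 2 / 4 ≤ ‖LAl N p m‖ ^ 2 := by nlinarith
  calc ‖dot (dbAl N p m) g‖ * (L * Real.sqrt L) ≤ (2 * Real.sqrt L * G) * (L * Real.sqrt L) :=
        mul_le_mul_of_nonneg_right hdot (by positivity)
    _ = 2 * G * L * (Real.sqrt L * Real.sqrt L) := by ring
    _ = 8 * G * (L ^ 2 / 4) := by rw [hsq]; ring
    _ ≤ 8 * G * ‖LAl N p m‖ ^ 2 := by gcongr

/-- [folklore] **LONGITUDINAL CONTENT OF THE FIELD SOLUTION ON THE STRIP**: `‖∂♭_m·Asol‖ = ‖cc‖/‖L_m(p)‖ ≤ 2‖cc‖/L`. -/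
theorem norm_dot_dbAl_Asol_strip (hre : ∀ i, |(p i).re| ≤ π) (him : ∀ i, |(p i).im| ≤ η) (hη : 0 ≤ η) (hη1 : η ≤ 1)
    (hsm : (3 * D / 2 + 2) * η ≤ 1 / 2) (hm : m ≠ 0) (g : Fin D → ℂ) (cc : ℂ) :
    ‖dot (dbAl N p m) (Asol (dAl N p m) (dbAl N p m) g (LAl N p m) cc)‖ ≤ 2 * ‖cc‖ / lapR (kfine N (reVec p) m) := by
  have hLpos : 0 < lapR (kfine N (reVec p) m) := lapR_pos_of_ne_zero (N := N) hre hm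
  have hLA := half_lapR_le_norm_LAl hre him hη hη1 hsm hm
  have hLA0 : 0 < ‖LAl N p m‖ := by linarith
  rw [norm_dot_Asol (dAl N p m) (dbAl N p m) g (LAl_ne_zero_of_strip hre him hη hη1 hsm hm) (dot_dbAl_dAl N p m) cc,
    div_le_div_iff₀ hLA0 hLpos]
  nlinarith [norm_nonneg cc]

/-! ## §3 `N`-scaled corollaries (`4 ≤ N²·L` for a nonzero alias) -/

/-- [folklore] `1/L ≤ N²/4`. -/
theorem inv_lapR_le (hre : ∀ i, |(p i).re| ≤ π) (hm : m ≠ 0) : 1 / lapR (kfine N (reVec p) m) ≤ (N : ℝ) ^ 2 / 4 := by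
  have h4 := four_le_sq_mul_lapR_re hre hm
  have hLpos : 0 < lapR (kfine N (reVec p) m) := lapR_pos_of_ne_zero (N := N) hre hm
  rw [div_le_div_iff₀ hLpos (by norm_num)]
  linarith

/-- [folklore] `1/√L ≤ N/2`. -/
theorem inv_sqrt_lapR_le (hre : ∀ i, |(p i).re| ≤ π) (hm : m ≠ 0) :
    1 / Real.sqrt (lapR (kfine N (reVec p) m)) ≤ (N : ℝ) / 2 := by
  have h4 := four_le_sq_mul_lapR_re hre hm
  have hLpos : 0 < lapR (kfine N (reVec p) m) := lapR_pos_of_ne_zero (N := N) hre hm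
  have hs0 : 0 < Real.sqrt (lapR (kfine N (reVec p) m)) := Real.sqrt_pos.2 hLpos
  have hN : (0 : ℝ) ≤ N := Nat.cast_nonneg N
  rw [div_le_div_iff₀ hs0 (by norm_num)]
  -- `2 ≤ N √L` from `4 ≤ N² L`
  have hsq : ((N : ℝ) * Real.sqrt (lapR (kfine N (reVec p) m))) ^ 2 = (N : ℝ) ^ 2 * lapR (kfine N (reVec p) m) := by
    rw [mul_pow, Real.sq_sqrt hLpos.le]
  nlinarith [sq_nonneg ((N : ℝ) * Real.sqrt (lapR (kfine N (reVec p) m)) - 2), mul_nonneg hN hs0.le]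

/-- [folklore] `1/(L√L) ≤ N³/8`. -/
theorem inv_lapR_sqrt_le (hre : ∀ i, |(p i).re| ≤ π) (hm : m ≠ 0) :
    1 / (lapR (kfine N (reVec p) m) * Real.sqrt (lapR (kfine N (reVec p) m))) ≤ (N : ℝ) ^ 3 / 8 := by
  have h1 := inv_lapR_le (N := N) hre hm
  have h2 := inv_sqrt_lapR_le (N := N) hre hm
  have hLpos : 0 < lapR (kfine N (reVec p) m) := lapR_pos_of_ne_zero (N := N) hre hm
  have hs0 : 0 < Real.sqrt (lapR (kfine N (reVec p) m)) := Real.sqrt_pos.2 hLpos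
  have h0 : 0 ≤ 1 / lapR (kfine N (reVec p) m) := by positivity
  have h0' : 0 ≤ 1 / Real.sqrt (lapR (kfine N (reVec p) m)) := by positivity
  calc 1 / (lapR (kfine N (reVec p) m) * Real.sqrt (lapR (kfine N (reVec p) m)))
      = (1 / lapR (kfine N (reVec p) m)) * (1 / Real.sqrt (lapR (kfine N (reVec p) m))) := by rw [one_div_mul_one_div]
    _ ≤ ((N : ℝ) ^ 2 / 4) * ((N : ℝ) / 2) := mul_le_mul h1 h2 h0' (by positivity)
    _ = (N : ℝ) ^ 3 / 8 := by ring

end Summit.QuantumFields.BalabanUV.Beta.GAN24.StripAliasBlockSolve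

end
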